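import Literature.Geometry.Lorentzian.CoordCurvature
import Mathlib.Analysis.Calculus.FDeriv.Symmetric
import HarnessLib

/-!
# Coordinate curvature calculus at a single point of finite smoothness

`CoordCurvature.lean` proves the classical identities of the coordinate tensor calculus
(metric compatibility, the first-kind formula for `G(R(X,Y)Z, W)`, the derivative of the
Koszul form) for components `G` that are `C^∞`, symmetric and nondegenerate on an OPEN SET
(`MetricCoord.IsMetricOn`). The Landau–Lifshitz pseudotensor estimate (LL §96 (96.8)) is a
statement about ONE point `x` and components that are merely `C²` at `x`, symmetric near `x` and
nondegenerate at `x`; this file re-proves the same identities under exactly these hypotheses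
(same proofs, pointwise bookkeeping):

* `fderiv_symm_of_eventually`, `fderiv_fderiv_symm_of_eventually` — `DG(x)v` and `D²G(x)(u,v)`
  are symmetric forms;
* `fderiv_eq_chrAt_of_contDiffAt` — metric compatibility `∂_X G(Y,Z) = G(Γ(X,Y),Z) + G(Y,Γ(X,Z))`;
* `hasFDerivAt_koszulCLM_of_differentiableAt`, `fderiv_koszulCLM_apply₃_of_differentiableAt` —
  `D K = koszulOp ∘ D²G`;
* `differentiableAt_chrAt_of_contDiffAt`, `apply_fderiv_chrAt_of_contDiffAt`,
  `apply_riemAt_of_contDiffAt` — the first-kind curvature formula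
  `G(R(X,Y)Z, W) = ½ (∂_X K(Y,Z,W) − ∂_Y K(X,Z,W)) − G(Γ(Y,Z), Γ(X,W)) + G(Γ(X,Z), Γ(Y,W))`.

## References
* B. O'Neill, *Semi-Riemannian geometry*, Academic Press 1983, Ch. 3, Prop. 3.13, Lemma 3.38.
  [ONeill1983]
-/

noncomputable section

set_option maxSynthPendingDepth 3

open Set Filter ContinuousLinearMap
open scoped Topology ContDiff Matrix

namespace Literature.Geometry.Lorentzian

namespace MetricCoord

variable {E : Type*} [NormedAddCommGroup E] [NormedSpace ℝ E]
  {G : E → E →L[ℝ] E →L[ℝ] ℝ} {x : E}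

/-! ### First and second derivatives of the components at a point -/

/-- `∂_v (G(·)(Y,Z))(x) = DG(x)(v)(Y)(Z)` for `G` differentiable at `x`. [folklore] -/
theorem fderiv_apply₂_of_differentiableAt (hd : DifferentiableAt ℝ G x) (Y Z v : E) :
    fderiv ℝ (fun y ↦ G y Y Z) x v = fderiv ℝ G x v Y Z := by
  have h1 : DifferentiableAt ℝ (fun y ↦ G y Y) x := differentiableAt_clm_apply_const hd Y
  rw [fderiv_clm_apply_const h1 Z v, fderiv_clm_apply_const hd Y v]

/-- `DG(x)(v)` is a symmetric form if `G` is symmetric near `x`. [folklore] -/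
theorem fderiv_symm_of_eventually (hd : DifferentiableAt ℝ G x)
    (hs : ∀ᶠ y in 𝓝 x, ∀ v w : E, G y v w = G y w v) (v Y Z : E) :
    fderiv ℝ G x v Y Z = fderiv ℝ G x v Z Y := by
  rw [← fderiv_apply₂_of_differentiableAt hd, ← fderiv_apply₂_of_differentiableAt hd]
  have heq : (fun y ↦ G y Y Z) =ᶠ[𝓝 x] fun y ↦ G y Z Y := hs.mono fun y hy ↦ hy Y Z
  rw [heq.fderiv_eq]

/-- `G` of class `C²` at `x` is differentiable at `x`. [folklore] -/
theorem differentiableAt_of_contDiffAt_two (hg : ContDiffAt ℝ 2 G x) : DifferentiableAt ℝ G x :=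
  hg.differentiableAt (by simp)

/-- `∂_u (DG(·)(v)(Y)(Z))(x) = D²G(x)(u)(v)(Y)(Z)` for `DG` differentiable at `x`. [folklore] -/
theorem fderiv_fderiv_apply₃_of_differentiableAt (hD : DifferentiableAt ℝ (fderiv ℝ G) x)
    (v Y Z u : E) :
    fderiv ℝ (fun y ↦ fderiv ℝ G y v Y Z) x u = fderiv ℝ (fderiv ℝ G) x u v Y Z := by
  have h1 : DifferentiableAt ℝ (fun y ↦ fderiv ℝ G y v) x := differentiableAt_clm_apply_const hD v
  have h2 : DifferentiableAt ℝ (fun y ↦ fderiv ℝ G y v Y) x := differentiableAt_clm_apply_const h1 Y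
  rw [fderiv_clm_apply_const h2 Z u, fderiv_clm_apply_const h1 Y u, fderiv_clm_apply_const hD v u]

/-- Symmetry of second derivatives at a `C²` point: `D²G(x)(u)(v) = D²G(x)(v)(u)`. [folklore] -/
theorem fderiv_fderiv_comm_of_contDiffAt (hg : ContDiffAt ℝ 2 G x) (u v : E) :
    fderiv ℝ (fderiv ℝ G) x u v = fderiv ℝ (fderiv ℝ G) x v u :=
  hg.isSymmSndFDerivAt (by simp) u v

/-- `D²G(x)(u)(v)` is a symmetric form if `G` is `C²` at `x` and symmetric near `x`. [folklore] -/
theorem fderiv_fderiv_symm_of_eventually (hg : ContDiffAt ℝ 2 G x)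
    (hs : ∀ᶠ y in 𝓝 x, ∀ v w : E, G y v w = G y w v) (u v Y Z : E) :
    fderiv ℝ (fderiv ℝ G) x u v Y Z = fderiv ℝ (fderiv ℝ G) x u v Z Y := by
  have hD : DifferentiableAt ℝ (fderiv ℝ G) x :=
    (hg.fderiv_right (m := 1) le_rfl).differentiableAt one_ne_zero
  rw [← fderiv_fderiv_apply₃_of_differentiableAt hD, ← fderiv_fderiv_apply₃_of_differentiableAt hD]
  have hdiff : ∀ᶠ y in 𝓝 x, DifferentiableAt ℝ G y := by
    filter_upwards [hg.eventually (by simp)] with y hy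
    exact hy.differentiableAt (by simp)
  have heq : (fun y ↦ fderiv ℝ G y v Y Z) =ᶠ[𝓝 x] fun y ↦ fderiv ℝ G y v Z Y := by
    filter_upwards [hdiff, hs.eventually_nhds] with y hy hy'
    exact fderiv_symm_of_eventually hy hy' v Y Z
  rw [heq.fderiv_eq]

/-! ### Metric compatibility at a point -/

/-- **Metric compatibility** at a point: `∂_X G(Y,Z) = G(Γ(X,Y), Z) + G(Y, Γ(X,Z))` for `G`
differentiable at `x`, symmetric near `x` and nondegenerate at `x`.
[cite: ONeill1983, Ch. 3, Prop. 3.13] -/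
theorem fderiv_eq_chrAt_of_differentiableAt (hd : DifferentiableAt ℝ G x)
    (hs : ∀ᶠ y in 𝓝 x, ∀ v w : E, G y v w = G y w v) (hx : (G x).IsInvertible) (X Y Z : E) :
    fderiv ℝ G x X Y Z = G x (chrAt G x X Y) Z + G x Y (chrAt G x X Z) := by
  have hsx : ∀ v w : E, G x v w = G x w v := hs.self_of_nhds
  rw [hsx Y (chrAt G x X Z), apply_chrAt hx, apply_chrAt hx]
  have h := koszulCLM_add_swap (fderiv_symm_of_eventually hd hs) X Y Z
  linarith

/-! ### The derivative of the Koszul form and of the Christoffel map at a point -/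

/-- `D K(x) = koszulOp ∘ D²G(x)` for `DG` differentiable at `x`. [folklore] -/
theorem hasFDerivAt_koszulCLM_of_differentiableAt (hD : DifferentiableAt ℝ (fderiv ℝ G) x) :
    HasFDerivAt (koszulCLM G) (koszulOp.comp (fderiv ℝ (fderiv ℝ G) x)) x :=
  koszulOp.hasFDerivAt.comp x hD.hasFDerivAt

/-- `∂_v K(·)(X,Y,Z)(x) = D²G(x)(v,X)(Y,Z) + D²G(x)(v,Y)(Z,X) − D²G(x)(v,Z)(X,Y)` for `DG`
differentiable at `x`. [folklore] -/
theorem fderiv_koszulCLM_apply₃_of_differentiableAt (hD : DifferentiableAt ℝ (fderiv ℝ G) x)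
    (X Y Z v : E) :
    fderiv ℝ (fun y ↦ koszulCLM G y X Y Z) x v =
      fderiv ℝ (fderiv ℝ G) x v X Y Z + fderiv ℝ (fderiv ℝ G) x v Y Z X
        - fderiv ℝ (fderiv ℝ G) x v Z X Y := by
  have hK : DifferentiableAt ℝ (koszulCLM G) x :=
    (hasFDerivAt_koszulCLM_of_differentiableAt hD).differentiableAt
  have h1 : DifferentiableAt ℝ (fun y ↦ koszulCLM G y X) x := differentiableAt_clm_apply_const hK X
  have h2 : DifferentiableAt ℝ (fun y ↦ koszulCLM G y X Y) x :=
    differentiableAt_clm_apply_const h1 Y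
  rw [fderiv_clm_apply_const h2 Z v, fderiv_clm_apply_const h1 Y v, fderiv_clm_apply_const hK X v,
    (hasFDerivAt_koszulCLM_of_differentiableAt hD).fderiv]
  rfl

/-- The components `y ↦ K_y(X,Y,Z)` are differentiable at `x` for `DG` differentiable at `x`.
[folklore] -/
theorem differentiableAt_koszulCLM_apply₃_of_differentiableAt
    (hD : DifferentiableAt ℝ (fderiv ℝ G) x) (X Y Z : E) :
    DifferentiableAt ℝ (fun y ↦ koszulCLM G y X Y Z) x := by
  have hK : DifferentiableAt ℝ (koszulCLM G) x :=
    (hasFDerivAt_koszulCLM_of_differentiableAt hD).differentiableAt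
  exact differentiableAt_clm_apply_const
    (differentiableAt_clm_apply_const (differentiableAt_clm_apply_const hK X) Y) Z

/-- Invertibility of `G` persists near a point where `G` is continuous (the invertible maps form
an open set). [folklore] -/
theorem eventually_isInvertible [CompleteSpace E] (hc : ContinuousAt G x)
    (hx : (G x).IsInvertible) : ∀ᶠ y in 𝓝 x, (G y).IsInvertible := by
  have hopen : IsOpen (range ((↑) : (E ≃L[ℝ] (E →L[ℝ] ℝ)) → E →L[ℝ] (E →L[ℝ] ℝ))) :=
    ContinuousLinearEquiv.isOpen
  have hmem : G x ∈ range ((↑) : (E ≃L[ℝ] (E →L[ℝ] ℝ)) → E →L[ℝ] (E →L[ℝ] ℝ)) := hx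
  exact hc.preimage_mem_nhds (hopen.mem_nhds hmem)

/-- `♯ = (G ·)⁻¹` is `C^n` at `x` if `G` is `C^n` at `x` and `G x` is invertible. [folklore] -/
theorem contDiffAt_sharpAt_of_contDiffAt [CompleteSpace E] {n : WithTop ℕ∞}
    (hg : ContDiffAt ℝ n G x) (hx : (G x).IsInvertible) : ContDiffAt ℝ n (sharpAt G) x :=
  hx.contDiffAt_map_inverse.comp x hg

/-- The Christoffel map is differentiable at `x` for `G` of class `C²` at `x` with `G x`
invertible. [folklore] -/
theorem differentiableAt_chrAt_of_contDiffAt [CompleteSpace E] (hg : ContDiffAt ℝ 2 G x)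
    (hx : (G x).IsInvertible) : DifferentiableAt ℝ (chrAt G) x := by
  have hS : DifferentiableAt ℝ (sharpAt G) x :=
    (contDiffAt_sharpAt_of_contDiffAt hg hx).differentiableAt (by simp)
  have hA : DifferentiableAt ℝ
      (fun y ↦ ContinuousLinearMap.compL ℝ E (E →L[ℝ] ℝ) E (sharpAt G y)) x :=
    (ContinuousLinearMap.compL ℝ E (E →L[ℝ] ℝ) E).differentiableAt.comp x hS
  have hK : DifferentiableAt ℝ (koszulCLM G) x :=
    (hasFDerivAt_koszulCLM_of_differentiableAt
      ((hg.fderiv_right (m := 1) le_rfl).differentiableAt one_ne_zero)).differentiableAt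
  have h := (hA.clm_comp hK).const_smul (2⁻¹ : ℝ)
  exact h

/-- `G(D_vΓ(X,Y), W) = ½ ∂_v K(X,Y,W) − DG(v)(Γ(X,Y), W)` at a `C²` point with `G x` invertible.
[folklore] -/
theorem apply_fderiv_chrAt_of_contDiffAt [CompleteSpace E] (hg : ContDiffAt ℝ 2 G x)
    (hx : (G x).IsInvertible) (v X Y W : E) :
    G x (fderiv ℝ (chrAt G) x v X Y) W =
      2⁻¹ * fderiv ℝ (fun y ↦ koszulCLM G y X Y W) x v - fderiv ℝ G x v (chrAt G x X Y) W := by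
  have hd := differentiableAt_of_contDiffAt_two hg
  have hD : DifferentiableAt ℝ (fderiv ℝ G) x :=
    (hg.fderiv_right (m := 1) le_rfl).differentiableAt one_ne_zero
  -- the product `y ↦ G y (Γ_y(X,Y))`, applied to `W`
  set c : E → E := fun y ↦ chrAt G y X Y with hc
  have hcd : HasFDerivAt c ((fderiv ℝ (chrAt G) x).flip X |>.flip Y) x := by
    have h1 := hasFDerivAt_clm_apply_const
      (differentiableAt_chrAt_of_contDiffAt hg hx).hasFDerivAt X
    exact hasFDerivAt_clm_apply_const h1 Y
  have hprod : HasFDerivAt (fun y ↦ G y (c y))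
      ((G x).comp ((fderiv ℝ (chrAt G) x).flip X |>.flip Y) + (fderiv ℝ G x).flip (c x)) x :=
    hd.hasFDerivAt.clm_apply hcd
  have hW := hasFDerivAt_clm_apply_const hprod W
  have hval : fderiv ℝ (fun y ↦ G y (c y) W) x v =
      G x (fderiv ℝ (chrAt G) x v X Y) W + fderiv ℝ G x v (chrAt G x X Y) W := by
    rw [hW.fderiv]
    rfl
  -- the same function is `½ K(X,Y,W)` near `x`
  have heq : (fun y ↦ G y (c y) W) =ᶠ[𝓝 x] fun y ↦ 2⁻¹ * koszulCLM G y X Y W :=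
    (eventually_isInvertible hg.continuousAt hx).mono fun y hy ↦ apply_chrAt hy X Y W
  have hval' : fderiv ℝ (fun y ↦ G y (c y) W) x v =
      2⁻¹ * fderiv ℝ (fun y ↦ koszulCLM G y X Y W) x v := by
    rw [heq.fderiv_eq,
      fderiv_const_mul (differentiableAt_koszulCLM_apply₃_of_differentiableAt hD X Y W)]
    rfl
  linarith

/-- **The curvature tensor in first-kind form at a point**:
`G(R(X,Y)Z, W) = ½ (∂_X K(Y,Z,W) − ∂_Y K(X,Z,W)) − G(Γ(Y,Z), Γ(X,W)) + G(Γ(X,Z), Γ(Y,W))`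
for `G` of class `C²` at `x`, symmetric near `x`, with `G x` invertible.
[cite: ONeill1983, Ch. 3, Lemma 3.38] -/
theorem apply_riemAt_of_contDiffAt [CompleteSpace E] (hg : ContDiffAt ℝ 2 G x)
    (hs : ∀ᶠ y in 𝓝 x, ∀ v w : E, G y v w = G y w v) (hx : (G x).IsInvertible) (X Y Z W : E) :
    G x (riemAt G x X Y Z) W =
      2⁻¹ * (fderiv ℝ (fun y ↦ koszulCLM G y Y Z W) x X - fderiv ℝ (fun y ↦ koszulCLM G y X Z W) x Y)
        - G x (chrAt G x Y Z) (chrAt G x X W) + G x (chrAt G x X Z) (chrAt G x Y W) := by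
  have hd := differentiableAt_of_contDiffAt_two hg
  have hsx : ∀ v w : E, G x v w = G x w v := hs.self_of_nhds
  rw [riemAt_apply, map_sub, map_add, map_sub, _root_.sub_apply,
    _root_.add_apply, _root_.sub_apply,
    apply_fderiv_chrAt_of_contDiffAt hg hx X Y Z W, apply_fderiv_chrAt_of_contDiffAt hg hx Y X Z W,
    fderiv_eq_chrAt_of_differentiableAt hd hs hx X (chrAt G x Y Z) W,
    fderiv_eq_chrAt_of_differentiableAt hd hs hx Y (chrAt G x X Z) W,
    hsx (chrAt G x Y Z) (chrAt G x X W), hsx (chrAt G x X Z) (chrAt G x Y W)]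
  ring

end MetricCoord

end Literature.Geometry.Lorentzian
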